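import Summits.Ventures.LatticeQCDFlow.Scaling.DominatedStarEntrySwap

/-!
HONEST FRAMING: exact (Metropolis-corrected) sampling algorithms for lattice gauge theory; figures
of merit are autocorrelation/cost numbers at stated couplings and volumes; no continuum-physics
claim.

# DominatedStarAugmentation — THE MAP-ASSISTED HOT-REFRESHED HUB WITH IMPERFECT TRANSPORTS, TAGGED WITH ITS STALE
# SET: THE AUGMENTED CHAIN `(configuration, stale set)` — GOOD TAG `σ_r(D)` WITH THE REGENERATION WEIGHT `γ_r`, BAD
# TAG `B_r(D)` WITH THE REST — IS A TRANSITION MATRIX LUMPING ONTO THE SCHEME `t·GSw + (1−t)·Π_w^M`, AND ITS ONE-STEP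
# ACTION ON LAWS IS EXPLICIT, ENTRY BY ENTRY AND SOURCE TAG BY SOURCE TAG (lean-2 GEN-25, ours)

Venture-side (OURS).  Cell `lqcd-flow` (pub-lqcd), unit `pub-lqcd-lean-2-g25`, 2026-08-27.  Chapter M (the
coupon-collector ceiling without perfect transports), file 4 — the augmentation.  THE SCHEME: hub list
`e_r = (0, κ_r + 1)` with maps `φ_r`, positive laws `μ_k`, Metropolis graph swap `GSw`, update weights `w` with
single-site kernels `M_k`, `P = t·GSw + (1−t)·Π_w^M` (chapters G–L).  THE AUGMENTED CHAIN `P̂` on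
`(Fin (K+1) → S) × Finset (Fin (K+1))` carries the STALE SET `D`: an update at the hot level erases `0` from `D`
(the sequel assumes the exact hot sampler `M_0(u,·) = μ_0`), cold updates leave `D` unchanged; an entry swap `r`
(cold level `l = κ_r+1`, proposal `y_r`, acceptance `α_r`, `Scaling/DominatedStarEntrySwap`) acts on the configuration
by `α_r(z)𝟙{z' = y_r z} + (1−α_r(z))𝟙{z' = z}` and on the tag by: GOOD tag `σ_r(D)` (`σ_r = (0 l)`) with weight
`γ_r(z,D)`, BAD tag `B_r(D)` with the remaining accepted weight `α_r − γ_r` and the rejected weight `1 − α_r`, where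
`γ_r(z,D) = α_r(z), β_r(z), β'_r(z), 0` according as `0, l ∉ D` ∕ `0 ∉ D ∋ l` ∕ `0 ∈ D ∌ l` ∕ `0, l ∈ D`, and
`B_r(D) = D` if `0, l ∉ D`, `D ∪ {0, l}` otherwise.  This file only uses `0 ≤ γ_r ≤ α_r`; everything is carried as
hypothesis-equations (no definitions).

## What is proved

* §1 `sum_ite_pairEq_one`, `sum_ite_eqAnd_tag`; **`dom_aug_isRowStochastic`**; **`dom_lump_fst`** (the configuration
  marginal of `P̂` is the scheme); **`dom_lawAt_fst`** (from `δ_{(x, univ)}` the configuration marginal at time `n` is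
  `δ_x Pⁿ`).
* §2 `sum_mul_coordKernel_at`, `sum_update_involution` (`Σ_z Σ_u H(z[k ↦ u], z_k) = Σ_z Σ_u H(z, u)`),
  `sum_ite_eqAnd_config(')`, and **`dom_stepLaw_apply`** — THE ONE-STEP ACTION ON A LAW, by entry and SOURCE tag:
  `(λP̂)(z',D') = Σ_r (t/m) Σ_D [𝟙{D' = σ_r D}·λ(y,D)γ_r(y,D) + 𝟙{D' = B_r D}·(λ(y,D)(α_r(y) − γ_r(y,D)) + λ(z',D)(1 − α_r(z')))]`
  `+ (1−t) Σ_k w_k Σ_{D : τ_k D = D'} Σ_u λ(z'[k ↦ u], D)·M_k(u, z'_k)` (`y = y_r z'`).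

Reading (no numerics implied): bookkeeping for `Scaling/DominatedStarFreshness`.  NOT CLAIMED here: anything
quantitative.  Literature grade (cell rule): OWN CONSTRUCTION; nothing cited as a fact; no new bib keys.
-/

noncomputable section

open Finset Function
open Literature.Probability.MarkovChains

namespace Summit.Ventures.LatticeQCDFlow.Scaling

variable {S : Type*} [Fintype S] [DecidableEq S] {K m : ℕ} {μ : Fin (K + 1) → S → ℝ} {M : Fin (K + 1) → S → S → ℝ}
  {w : Fin (K + 1) → ℝ} {t p q : ℝ}

section Aug
variable (κ : Fin m → Fin K) (φ : Fin m → Equiv.Perm S)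

/-! ## §1 The augmented chain: a transition matrix lumping onto the scheme -/

/-- `Σ_b 𝟙{b.1 = y ∧ b.2 = E} = 1`. [ours] -/
theorem sum_ite_pairEq_one (y : Fin (K + 1) → S) (E : Finset (Fin (K + 1))) :
    ∑ b : (Fin (K + 1) → S) × Finset (Fin (K + 1)), (if b.1 = y ∧ b.2 = E then (1 : ℝ) else 0) = 1 := by
  rw [Finset.sum_eq_single (y, E)]
  · rw [if_pos ⟨rfl, rfl⟩]
  · intro b _ hb; rw [if_neg]; rintro ⟨h1, h2⟩; exact hb (Prod.ext h1 h2)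
  · intro h; exact absurd (mem_univ _) h

omit [Fintype S] in
/-- `Σ_{D'} 𝟙{z' = y ∧ D' = E} = 𝟙{z' = y}`. [ours] -/
theorem sum_ite_eqAnd_tag (z' y : Fin (K + 1) → S) (E : Finset (Fin (K + 1))) :
    ∑ D' : Finset (Fin (K + 1)), (if z' = y ∧ D' = E then (1 : ℝ) else 0) = if z' = y then (1 : ℝ) else 0 := by
  by_cases h : z' = y
  · subst h
    simp only [true_and, if_true]
    rw [Finset.sum_ite_eq' univ E, if_pos (mem_univ _)]
  · rw [if_neg h]; exact sum_eq_zero fun D' _ => if_neg fun h' => h h'.1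

/-- **The augmented chain is a transition matrix** (`0 ≤ t ≤ 1`, `m ≥ 1`, `w` a probability vector, `M_k`
row-stochastic, `0 ≤ γ_r ≤ α_r ≤ 1`). [ours] -/
theorem dom_aug_isRowStochastic (hm : 1 ≤ m) (ht0 : 0 ≤ t) (ht1 : t ≤ 1) (hw0 : ∀ k, 0 ≤ w k) (hw1 : ∑ k, w k = 1)
    (hM : ∀ k, IsRowStochastic (M k)) (hμ : ∀ k x, 0 < μ k x)
    {α : Fin m → (Fin (K + 1) → S) → ℝ}
    (hα : ∀ r z, α r z = min 1 (tensorFun μ (edgeFlowSwap (φ r) 0 (κ r).succ z) / tensorFun μ z))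
    {γ : Fin m → (Fin (K + 1) → S) × Finset (Fin (K + 1)) → ℝ} (hγα : ∀ r a, 0 ≤ γ r a ∧ γ r a ≤ α r a.1)
    {Bset : Fin m → Finset (Fin (K + 1)) → Finset (Fin (K + 1))}
    {Ph : (Fin (K + 1) → S) × Finset (Fin (K + 1)) → (Fin (K + 1) → S) × Finset (Fin (K + 1)) → ℝ}
    (hPh : ∀ a b, Ph a b = ∑ r : Fin m, t / m *
        (γ r a * (if b.1 = edgeFlowSwap (φ r) 0 (κ r).succ a.1 ∧ b.2 = a.2.image (Equiv.swap (0 : Fin (K + 1)) (κ r).succ)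
            then (1 : ℝ) else 0)
          + (α r a.1 - γ r a) * (if b.1 = edgeFlowSwap (φ r) 0 (κ r).succ a.1 ∧ b.2 = Bset r a.2 then (1 : ℝ) else 0)
          + (1 - α r a.1) * (if b.1 = a.1 ∧ b.2 = Bset r a.2 then (1 : ℝ) else 0))
      + (1 - t) * ∑ k : Fin (K + 1), w k * (coordKernel M k a.1 b.1
          * (if b.2 = (if k = 0 then a.2.erase 0 else a.2) then (1 : ℝ) else 0))) :
    IsRowStochastic Ph := by
  have hmpos : (0 : ℝ) < m := Nat.cast_pos.mpr (by omega)
  refine ⟨fun a b => ?_, fun a => ?_⟩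
  · rw [hPh]
    have hg := hγα
    refine add_nonneg (sum_nonneg fun r _ => mul_nonneg (by positivity) (add_nonneg (add_nonneg ?_ ?_) ?_))
      (mul_nonneg (by linarith) (sum_nonneg fun k _ => mul_nonneg (hw0 k) (mul_nonneg
        (coordKernel_nonneg M (fun j u v => (hM j).1 u v) k _ _) (by split_ifs <;> norm_num))))
    · exact mul_nonneg (hg r a).1 (by split_ifs <;> norm_num)
    · exact mul_nonneg (by linarith [(hg r a).2]) (by split_ifs <;> norm_num)
    · exact mul_nonneg (by linarith [(accept_mem κ φ hμ hα r a.1).2]) (by split_ifs <;> norm_num)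
  · have hswap : ∀ r : Fin m, ∑ b : (Fin (K + 1) → S) × Finset (Fin (K + 1)),
        (γ r a * (if b.1 = edgeFlowSwap (φ r) 0 (κ r).succ a.1 ∧ b.2 = a.2.image (Equiv.swap (0 : Fin (K + 1)) (κ r).succ)
            then (1 : ℝ) else 0)
          + (α r a.1 - γ r a) * (if b.1 = edgeFlowSwap (φ r) 0 (κ r).succ a.1 ∧ b.2 = Bset r a.2 then (1 : ℝ) else 0)
          + (1 - α r a.1) * (if b.1 = a.1 ∧ b.2 = Bset r a.2 then (1 : ℝ) else 0)) = 1 := by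
      intro r
      rw [Finset.sum_add_distrib, Finset.sum_add_distrib, ← Finset.mul_sum, ← Finset.mul_sum, ← Finset.mul_sum,
        sum_ite_pairEq_one, sum_ite_pairEq_one, sum_ite_pairEq_one]
      ring
    have hupd : ∀ k : Fin (K + 1), ∑ b : (Fin (K + 1) → S) × Finset (Fin (K + 1)),
        coordKernel M k a.1 b.1 * (if b.2 = (if k = 0 then a.2.erase 0 else a.2) then (1 : ℝ) else 0) = 1 := by
      intro k
      rw [Fintype.sum_prod_type]
      simp_rw [← Finset.mul_sum, Finset.sum_ite_eq' univ, if_pos (mem_univ _), mul_one]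
      have h := sum_coordKernel_mul M k a.1 (fun _ => (1 : ℝ))
      simp only [mul_one] at h
      rw [h, (hM k).2]
    have hsplit : ∑ b, Ph a b = ∑ r : Fin m, t / m * 1 + (1 - t) * ∑ k : Fin (K + 1), w k * 1 := by
      simp_rw [hPh]
      rw [Finset.sum_add_distrib, Finset.sum_comm, ← Finset.mul_sum]
      congr 1
      · refine sum_congr rfl fun r _ => ?_
        rw [← Finset.mul_sum, hswap r]
      · congr 1
        rw [Finset.sum_comm]
        refine sum_congr rfl fun k _ => ?_
        rw [← Finset.mul_sum, hupd k]
    rw [hsplit]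
    simp_rw [mul_one, sum_const, card_univ, Fintype.card_fin, nsmul_eq_mul, hw1]
    field_simp
    ring

/-- **FIRST LUMPING: the configuration marginal of `P̂` is the scheme `t·GSw + (1−t)·Π_w^M`** (`m ≥ 1`, `μ > 0`).
[ours] -/
theorem dom_lump_fst (hm : 1 ≤ m) (hμ : ∀ k x, 0 < μ k x)
    {α : Fin m → (Fin (K + 1) → S) → ℝ}
    (hα : ∀ r z, α r z = min 1 (tensorFun μ (edgeFlowSwap (φ r) 0 (κ r).succ z) / tensorFun μ z))
    {γ : Fin m → (Fin (K + 1) → S) × Finset (Fin (K + 1)) → ℝ}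
    {Bset : Fin m → Finset (Fin (K + 1)) → Finset (Fin (K + 1))}
    {Ph : (Fin (K + 1) → S) × Finset (Fin (K + 1)) → (Fin (K + 1) → S) × Finset (Fin (K + 1)) → ℝ}
    (hPh : ∀ a b, Ph a b = ∑ r : Fin m, t / m *
        (γ r a * (if b.1 = edgeFlowSwap (φ r) 0 (κ r).succ a.1 ∧ b.2 = a.2.image (Equiv.swap (0 : Fin (K + 1)) (κ r).succ)
            then (1 : ℝ) else 0)
          + (α r a.1 - γ r a) * (if b.1 = edgeFlowSwap (φ r) 0 (κ r).succ a.1 ∧ b.2 = Bset r a.2 then (1 : ℝ) else 0)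
          + (1 - α r a.1) * (if b.1 = a.1 ∧ b.2 = Bset r a.2 then (1 : ℝ) else 0))
      + (1 - t) * ∑ k : Fin (K + 1), w k * (coordKernel M k a.1 b.1
          * (if b.2 = (if k = 0 then a.2.erase 0 else a.2) then (1 : ℝ) else 0)))
    (a : (Fin (K + 1) → S) × Finset (Fin (K + 1))) (z' : Fin (K + 1) → S) :
    t * ptGraphSwap μ (fun r : Fin m => (((0 : Fin (K + 1)), (κ r).succ) : Fin (K + 1) × Fin (K + 1))) φ a.1 z'
        + (1 - t) * prodKernel w M a.1 z'
      = ∑ b ∈ univ.filter (fun b : (Fin (K + 1) → S) × Finset (Fin (K + 1)) => b.1 = z'), Ph a b := by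
  have he := hubList_fst_ne_snd (K := K) κ
  rw [sum_filter_prodFst_eq, ptGraphSwap_eq_avg_entryKernel hm he hμ, prodKernel_apply]
  simp_rw [hPh, Finset.sum_add_distrib]
  congr 1
  · rw [Finset.mul_sum, Finset.sum_comm]
    refine sum_congr rfl fun r _ => ?_
    rw [← Finset.mul_sum, Finset.sum_add_distrib, Finset.sum_add_distrib, ← Finset.mul_sum, ← Finset.mul_sum,
      ← Finset.mul_sum, sum_ite_eqAnd_tag, sum_ite_eqAnd_tag, sum_ite_eqAnd_tag,
      entrySwap_eq_accept_reject κ φ hμ hα r a.1 z']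
    ring
  · rw [← Finset.mul_sum]
    congr 1
    rw [Finset.sum_comm]
    refine sum_congr rfl fun k _ => ?_
    rw [← Finset.mul_sum, ← Finset.mul_sum, Finset.sum_ite_eq' univ, if_pos (mem_univ _), mul_one]

/-- **From `δ_{(x, univ)}`: the configuration marginal of `P̂` at time `n` is `δ_x Pⁿ`.** [ours] -/
theorem dom_lawAt_fst (hm : 1 ≤ m) (hμ : ∀ k x, 0 < μ k x)
    {α : Fin m → (Fin (K + 1) → S) → ℝ}
    (hα : ∀ r z, α r z = min 1 (tensorFun μ (edgeFlowSwap (φ r) 0 (κ r).succ z) / tensorFun μ z))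
    {γ : Fin m → (Fin (K + 1) → S) × Finset (Fin (K + 1)) → ℝ}
    {Bset : Fin m → Finset (Fin (K + 1)) → Finset (Fin (K + 1))}
    {Ph : (Fin (K + 1) → S) × Finset (Fin (K + 1)) → (Fin (K + 1) → S) × Finset (Fin (K + 1)) → ℝ}
    (hPh : ∀ a b, Ph a b = ∑ r : Fin m, t / m *
        (γ r a * (if b.1 = edgeFlowSwap (φ r) 0 (κ r).succ a.1 ∧ b.2 = a.2.image (Equiv.swap (0 : Fin (K + 1)) (κ r).succ)
            then (1 : ℝ) else 0)
          + (α r a.1 - γ r a) * (if b.1 = edgeFlowSwap (φ r) 0 (κ r).succ a.1 ∧ b.2 = Bset r a.2 then (1 : ℝ) else 0)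
          + (1 - α r a.1) * (if b.1 = a.1 ∧ b.2 = Bset r a.2 then (1 : ℝ) else 0))
      + (1 - t) * ∑ k : Fin (K + 1), w k * (coordKernel M k a.1 b.1
          * (if b.2 = (if k = 0 then a.2.erase 0 else a.2) then (1 : ℝ) else 0)))
    (x : Fin (K + 1) → S) (n : ℕ) (z : Fin (K + 1) → S) :
    ∑ D : Finset (Fin (K + 1)), lawAt Ph (Pi.single (x, (univ : Finset (Fin (K + 1)))) 1) n (z, D)
      = lawAt (fun y z : Fin (K + 1) → S =>
          t * ptGraphSwap μ (fun r : Fin m => (((0 : Fin (K + 1)), (κ r).succ) : Fin (K + 1) × Fin (K + 1))) φ y z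
          + (1 - t) * prodKernel w M y z) (Pi.single x 1) n z := by
  rw [← sum_filter_prodFst_eq (fun b => lawAt Ph (Pi.single (x, (univ : Finset (Fin (K + 1)))) 1) n b) z,
    LevinPeres2017_lemma_2_5_lawAt (P := Ph) (proj := Prod.fst)
      (Ps := fun y z : Fin (K + 1) → S =>
          t * ptGraphSwap μ (fun r : Fin m => (((0 : Fin (K + 1)), (κ r).succ) : Fin (K + 1) × Fin (K + 1))) φ y z
          + (1 - t) * prodKernel w M y z)
      (fun a z' => dom_lump_fst κ φ hm hμ hα hPh a z')]
  congr 1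
  funext z'
  exact sum_filter_prodFst_single x univ z'

/-! ## §2 The one-step action on laws, organised by entry and source tag -/

/-- **Integrating a function against a coordinate kernel:** `Σ_z f(z)·coordKernel M k (z,z') = Σ_u f(z'[k ↦ u])·M_k(u, z'_k)`.
[ours] -/
theorem sum_mul_coordKernel_at (f : (Fin (K + 1) → S) → ℝ) (k : Fin (K + 1)) (z' : Fin (K + 1) → S) :
    ∑ z, f z * coordKernel M k z z' = ∑ u : S, f (update z' k u) * M k u (z' k) := by
  have hck : ∀ z : Fin (K + 1) → S, coordKernel M k z z' = ∑ u : S, (if z = update z' k u then M k u (z' k) else 0) := by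
    intro z
    unfold coordKernel
    by_cases hz : z' = update z k (z' k)
    · rw [if_pos hz]
      have hzu : z = update z' k (z k) := by
        conv_lhs => rw [← update_eq_self k z]
        rw [hz, update_idem]
      rw [Finset.sum_eq_single (z k)]
      · rw [if_pos hzu]
      · intro u _ hu
        rw [if_neg]
        intro h; apply hu; have := congrFun h k; rw [update_self] at this; exact this.symm
      · intro h; exact absurd (mem_univ _) h
    · rw [if_neg hz]
      refine (sum_eq_zero fun u _ => if_neg fun h => hz ?_).symm
      rw [h, update_idem, update_eq_self]
  simp_rw [hck, mul_sum]
  rw [Finset.sum_comm]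
  refine sum_congr rfl fun u _ => ?_
  simp_rw [mul_ite, mul_zero]
  rw [Finset.sum_ite_eq' univ (update z' k u), if_pos (mem_univ _)]

omit [Fintype S] [DecidableEq S] in
/-- **The update involution:** `(z, u) ↦ (z[k ↦ u], z_k)` is an involution of `(Fin (K+1) → S) × S`, so
`Σ_z Σ_u H(z[k ↦ u], z_k) = Σ_z Σ_u H(z, u)`. [ours] -/
theorem sum_update_involution [Fintype S] (k : Fin (K + 1)) (H : (Fin (K + 1) → S) → S → ℝ) :
    ∑ z : Fin (K + 1) → S, ∑ u : S, H (update z k u) (z k) = ∑ z : Fin (K + 1) → S, ∑ u : S, H z u := by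
  have hinv : Function.Involutive (fun zu : (Fin (K + 1) → S) × S => (update zu.1 k zu.2, zu.1 k)) := by
    intro zu
    dsimp only
    rw [update_idem, update_self, update_eq_self]
  rw [← Fintype.sum_prod_type' (fun z u => H (update z k u) (z k)), ← Fintype.sum_prod_type' H]
  exact Equiv.sum_comp (hinv.toPerm _) (fun zu : (Fin (K + 1) → S) × S => H zu.1 zu.2)

/-- `Σ_z 𝟙{z = c ∧ P}·f(z) = 𝟙{P}·f(c)`. [ours] -/
theorem sum_ite_eqAnd_config (f : (Fin (K + 1) → S) → ℝ) (c : Fin (K + 1) → S) (P : Prop) [Decidable P] :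
    ∑ z : Fin (K + 1) → S, (if z = c ∧ P then f z else 0) = if P then f c else 0 := by
  by_cases hP : P
  · simp_rw [hP, and_true, if_true]; rw [Finset.sum_ite_eq' univ c, if_pos (mem_univ _)]
  · simp_rw [hP, and_false, if_false]; exact sum_const_zero

/-- `Σ_z 𝟙{c = z ∧ P}·f(z) = 𝟙{P}·f(c)`. [ours] -/
theorem sum_ite_eqAnd_config' (f : (Fin (K + 1) → S) → ℝ) (c : Fin (K + 1) → S) (P : Prop) [Decidable P] :
    ∑ z : Fin (K + 1) → S, (if c = z ∧ P then f z else 0) = if P then f c else 0 := by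
  by_cases hP : P
  · simp_rw [hP, and_true, if_true]; rw [Finset.sum_ite_eq univ c, if_pos (mem_univ _)]
  · simp_rw [hP, and_false, if_false]; exact sum_const_zero

/-- **THE ONE-STEP ACTION OF `P̂` ON A LAW `λ`, BY ENTRY AND SOURCE TAG:** with `y = y_r(z')`,
`(λP̂)(z',D') = Σ_r (t/m)·Σ_D [𝟙{D' = σ_r D}·λ(y,D)γ_r(y,D) + 𝟙{D' = B_r D}·(λ(y,D)(α_r(y) − γ_r(y,D)) + λ(z',D)(1 − α_r(z')))]`
`+ (1−t)·Σ_k w_k·Σ_{D : τ_k D = D'} Σ_u λ(z'[k ↦ u], D)·M_k(u, z'_k)` (`τ_0 D = D ∖ {0}`, `τ_k D = D` else). [ours] -/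
theorem dom_stepLaw_apply
    {α : Fin m → (Fin (K + 1) → S) → ℝ} {γ : Fin m → (Fin (K + 1) → S) × Finset (Fin (K + 1)) → ℝ}
    {Bset : Fin m → Finset (Fin (K + 1)) → Finset (Fin (K + 1))}
    {Ph : (Fin (K + 1) → S) × Finset (Fin (K + 1)) → (Fin (K + 1) → S) × Finset (Fin (K + 1)) → ℝ}
    (hPh : ∀ a b, Ph a b = ∑ r : Fin m, t / m *
        (γ r a * (if b.1 = edgeFlowSwap (φ r) 0 (κ r).succ a.1 ∧ b.2 = a.2.image (Equiv.swap (0 : Fin (K + 1)) (κ r).succ)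
            then (1 : ℝ) else 0)
          + (α r a.1 - γ r a) * (if b.1 = edgeFlowSwap (φ r) 0 (κ r).succ a.1 ∧ b.2 = Bset r a.2 then (1 : ℝ) else 0)
          + (1 - α r a.1) * (if b.1 = a.1 ∧ b.2 = Bset r a.2 then (1 : ℝ) else 0))
      + (1 - t) * ∑ k : Fin (K + 1), w k * (coordKernel M k a.1 b.1
          * (if b.2 = (if k = 0 then a.2.erase 0 else a.2) then (1 : ℝ) else 0)))
    (lam : (Fin (K + 1) → S) × Finset (Fin (K + 1)) → ℝ) (z' : Fin (K + 1) → S) (D' : Finset (Fin (K + 1))) :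
    stepLaw Ph lam (z', D')
      = ∑ r : Fin m, t / m * ∑ D : Finset (Fin (K + 1)),
          ((if D' = D.image (Equiv.swap (0 : Fin (K + 1)) (κ r).succ) then (1 : ℝ) else 0)
              * (lam (edgeFlowSwap (φ r) 0 (κ r).succ z', D) * γ r (edgeFlowSwap (φ r) 0 (κ r).succ z', D))
            + (if D' = Bset r D then (1 : ℝ) else 0)
              * (lam (edgeFlowSwap (φ r) 0 (κ r).succ z', D)
                  * (α r (edgeFlowSwap (φ r) 0 (κ r).succ z') - γ r (edgeFlowSwap (φ r) 0 (κ r).succ z', D))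
                + lam (z', D) * (1 - α r z')))
        + (1 - t) * ∑ k : Fin (K + 1), w k *
            ∑ D ∈ univ.filter (fun D : Finset (Fin (K + 1)) => (if k = 0 then D.erase 0 else D) = D'),
              ∑ u : S, lam (update z' k u, D) * M k u (z' k) := by
  have he := hubList_fst_ne_snd (K := K) κ
  have hinv := entrySwap_entrySwap κ φ
  -- split every summand `λ(a)·P̂(a, (z',D'))` into its entry part and its update part
  have key : ∀ (z : Fin (K + 1) → S) (D : Finset (Fin (K + 1))), lam (z, D) * Ph (z, D) (z', D')
      = (∑ r : Fin m, t / m * (lam (z, D) *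
          (γ r (z, D) * (if z' = edgeFlowSwap (φ r) 0 (κ r).succ z ∧ D' = D.image (Equiv.swap (0 : Fin (K + 1)) (κ r).succ)
              then (1 : ℝ) else 0)
            + (α r z - γ r (z, D)) * (if z' = edgeFlowSwap (φ r) 0 (κ r).succ z ∧ D' = Bset r D then (1 : ℝ) else 0)
            + (1 - α r z) * (if z' = z ∧ D' = Bset r D then (1 : ℝ) else 0))))
        + ∑ k : Fin (K + 1), (1 - t) * (w k * (lam (z, D) * (coordKernel M k z z'
            * (if D' = (if k = 0 then D.erase 0 else D) then (1 : ℝ) else 0)))) := by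
    intro z D
    rw [hPh, mul_add, Finset.mul_sum, Finset.mul_sum, Finset.mul_sum]
    congr 1
    · exact sum_congr rfl fun r _ => by ring
    · exact sum_congr rfl fun k _ => by ring
  unfold stepLaw
  rw [Fintype.sum_prod_type]
  simp_rw [key, Finset.sum_add_distrib]
  -- reorder the sums: `Σ_z Σ_D Σ_r → Σ_r Σ_D Σ_z` and `Σ_z Σ_D Σ_k → Σ_k Σ_D Σ_z`
  rw [Finset.sum_comm (s := (univ : Finset (Fin (K + 1) → S))) (t := (univ : Finset (Finset (Fin (K + 1)))))
      (f := fun z D => ∑ r : Fin m, t / m * (lam (z, D) *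
          (γ r (z, D) * (if z' = edgeFlowSwap (φ r) 0 (κ r).succ z ∧ D' = D.image (Equiv.swap (0 : Fin (K + 1)) (κ r).succ)
              then (1 : ℝ) else 0)
            + (α r z - γ r (z, D)) * (if z' = edgeFlowSwap (φ r) 0 (κ r).succ z ∧ D' = Bset r D then (1 : ℝ) else 0)
            + (1 - α r z) * (if z' = z ∧ D' = Bset r D then (1 : ℝ) else 0)))),
    Finset.sum_comm (s := (univ : Finset (Fin (K + 1) → S))) (t := (univ : Finset (Finset (Fin (K + 1)))))
      (f := fun z D => ∑ k : Fin (K + 1), (1 - t) * (w k * (lam (z, D) * (coordKernel M k z z'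
            * (if D' = (if k = 0 then D.erase 0 else D) then (1 : ℝ) else 0)))))]
  simp only [Finset.sum_comm (s := (univ : Finset (Fin (K + 1) → S))) (t := (univ : Finset (Fin m))),
    Finset.sum_comm (s := (univ : Finset (Fin (K + 1) → S))) (t := (univ : Finset (Fin (K + 1))))]
  rw [Finset.sum_comm (s := (univ : Finset (Finset (Fin (K + 1))))) (t := (univ : Finset (Fin m))),
    Finset.sum_comm (s := (univ : Finset (Finset (Fin (K + 1))))) (t := (univ : Finset (Fin (K + 1))))]
  congr 1
  · -- entry part: for each `r` and source tag `D`, integrate out `z`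
    refine sum_congr rfl fun r _ => ?_
    rw [← Finset.sum_add_distrib, Finset.mul_sum]
    refine sum_congr rfl fun D _ => ?_
    rw [← Finset.mul_sum]
    congr 1
    have hinvz : ∀ z : Fin (K + 1) → S, z' = edgeFlowSwap (φ r) 0 (κ r).succ z ↔
        z = edgeFlowSwap (φ r) 0 (κ r).succ z' := fun z => eq_edgeFlowSwap_comm _ (he r) z z'
    have h1 : ∀ z : Fin (K + 1) → S, lam (z, D) *
        (γ r (z, D) * (if z' = edgeFlowSwap (φ r) 0 (κ r).succ z ∧ D' = D.image (Equiv.swap (0 : Fin (K + 1)) (κ r).succ)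
            then (1 : ℝ) else 0)
          + (α r z - γ r (z, D)) * (if z' = edgeFlowSwap (φ r) 0 (κ r).succ z ∧ D' = Bset r D then (1 : ℝ) else 0)
          + (1 - α r z) * (if z' = z ∧ D' = Bset r D then (1 : ℝ) else 0))
        = (if z = edgeFlowSwap (φ r) 0 (κ r).succ z' ∧ D' = D.image (Equiv.swap (0 : Fin (K + 1)) (κ r).succ)
              then lam (z, D) * γ r (z, D) else 0)
          + (if z = edgeFlowSwap (φ r) 0 (κ r).succ z' ∧ D' = Bset r D then lam (z, D) * (α r z - γ r (z, D)) else 0)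
          + (if z' = z ∧ D' = Bset r D then lam (z, D) * (1 - α r z) else 0) := by
      intro z
      simp only [hinvz z]
      split_ifs <;> ring
    rw [sum_congr rfl (fun z _ => h1 z), Finset.sum_add_distrib, Finset.sum_add_distrib, sum_ite_eqAnd_config,
      sum_ite_eqAnd_config, sum_ite_eqAnd_config']
    split_ifs <;> ring
  · -- update part: for each `k` and source tag `D`, integrate out `z`
    rw [Finset.mul_sum]
    refine sum_congr rfl fun k _ => ?_
    rw [Finset.sum_filter, Finset.mul_sum, Finset.mul_sum]
    refine sum_congr rfl fun D _ => ?_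
    by_cases hD : (if k = 0 then D.erase 0 else D) = D'
    · rw [if_pos hD]
      simp_rw [if_pos hD.symm, mul_one]
      have h := sum_mul_coordKernel_at (M := M) (fun z => lam (z, D)) k z'
      calc ∑ z, (1 - t) * (w k * (lam (z, D) * coordKernel M k z z'))
          = (1 - t) * (w k * ∑ z, lam (z, D) * coordKernel M k z z') := by
            rw [Finset.mul_sum, Finset.mul_sum]
        _ = (1 - t) * (w k * ∑ u : S, lam (update z' k u, D) * M k u (z' k)) := by rw [h]
    · rw [if_neg hD, mul_zero, mul_zero]
      have hD' : ¬ (D' = (if k = 0 then D.erase 0 else D)) := fun h => hD h.symm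
      simp_rw [if_neg hD', mul_zero]
      simp

end Aug

end Summit.Ventures.LatticeQCDFlow.Scaling

end
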